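import Summits.QuantumFields.YangMills.Theorems.VirialFluxGapSharpTwistedLaplaceQuantitativeLaplaceGauss
import HarnessLib

/-!
# Laplace's method with an EXPLICIT, DIMENSION-POLYNOMIAL remainder `O(1/β)`
# (interior non-degenerate minimum, parity-improved second order)

Helper module (free-hands work of width seat ym-line-sfw-p2-w2 g49, cell ym-idea-1) toward crux
⟨stmt-QuantumFields-24204⟩ `VirialFluxGap.SharpTwistedLaplace` (r301 of route VirialFluxGap; the leaf served by
LINE g15-A route TwistEaterVolume ∕ ⟨24319⟩ TubeVolumeLaw) by the DIRECT Laplace method at the twist-eater orbits: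
the leaf's window `L ≤ β^a` allows `β ≥ poly(L)`, so `log ∫e^{−βF_z}dμ = −9L⁴·log β + C(L,z) ± K·L^q/β` needs a
Laplace remainder with constants POLYNOMIAL IN THE DIMENSION `m = 18L⁴` and of order `1/β` (not `β^{−1/2}`).
The tree's Laplace files (`Literature/Analysis/Asymptotics/LaplaceMethodMultivariate`, `…MorseBottFibred`,
`…Chart`, `…Orbit*`, `…CompactGroup*`) are LIMIT statements at fixed dimension; this module is the quantitative
Euclidean core (the orbit ∕ slice and chart layers with `poly(L)` constants are the remaining steps, to be
consumed with it exactly as with the limit form).  Everything here is PROVED; no definitions, no named facts;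
pure real analysis (namespace `Summit.QuantumFields.YangMills.Theorems.QuantitativeLaplace`).
THIS FILE = PART 2/3 (§3a pointwise second-order bounds on the ball); part 1/3 = `…QuantitativeLaplaceGauss`, part 3/3 = `…QuantitativeLaplaceMethod` (★★ `laplaceMethod_quantitative`).

THE STATEMENT (★★ `laplaceMethod_quantitative`, consumer form `laplaceMethod_quantitative_of_eqOn`).
`V` a real inner product space of dimension `m`, Lebesgue measure; `A` symmetric with `λ‖y‖² ≤ ⟪Ay, y⟫`
(`λ > 0`); on the closed ball `‖y‖ ≤ R` a phase `f = ½⟪Ay,y⟫ + c + r` and a weight `w = w₀(1 + ℓ + e)` with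
`c`, `ℓ` ODD (`c(−y) = −c(y)`, `ℓ(−y) = −ℓ(y)`; e.g. the cubic Taylor form of the phase and the linear Taylor
form of the weight), `|c| ≤ A₃‖y‖³`, `|r| ≤ A₄‖y‖⁴`, `|ℓ| ≤ D‖y‖`, `|e| ≤ G‖y‖²` on the ball
(`A₃, A₄, D, G ≥ 0`, `c, r, ℓ, e` measurable), and the smallness of the window
`A₃R + A₄R² ≤ λ/(8(m+8))`, `DR ≤ 1`, `GR² ≤ 1`.  THEN for every `β > 0`

  `|∫_{‖y‖≤R} e^{−βf} w dy − w₀𝔊(β)| ≤ (K/β)·w₀𝔊(β)`,  `𝔊(β) = (2π/β)^{m/2}/√det A`,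

with the EXPLICIT constant
`K = 16(m+8)/(λR²) + 16G(m+8)/λ + 256(A₄ + (A₃+A₄R)(D+GR))(m+8)²/λ² + 18432(A₃+A₄R)²(m+8)³/λ³`
— polynomial in the dimension and in the data; no hypothesis couples `β` to the data (the tail off the
ball is paid by the linear Markov bound `1 ≤ 2q/(λR²)`, at the price `16(m+8)/(λR²β)`).  The first-order
terms `−βc + ℓ` are odd and integrate to zero against the even Gaussian on the symmetric ball, which is
why the remainder is `O(1/β)` and not `O(β^{−1/2})` (the integer-power structure of the Laplace expansion
at an interior non-degenerate critical point); the second-order terms are bounded by Gaussian moments,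
estimated by the pointwise bound `qᵏe^{−εβq} ≤ k!/(εβ)ᵏ` (`ε = 1/(4(m+8))`) at the price of the factor
`(1 − 1/(2(m+8)))^{−m/2} ≤ 2`, so that no constant exponential in `m` appears.  Structure of the proof:
§1 elementary inequalities; §2 the scaled anisotropic Gaussian `∫e^{−s·½⟪Ay,y⟫} = (2π/s)^{m/2}/√det A`,
the moment bound `integral_pow_mul_exp_neg_le`, the odd-integrand lemma; §3 the pointwise second-order
bound on the ball (`laplace_pointwise_remainder_le`), the tail (`laplace_tail_le`), the remainder integral
(`laplace_remainder_integral_le`), assembly.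

WHY (the use).  «`β → ∞` at a box that GROWS with `β`» statements (e.g. Laplace windows `L ≤ β^a` of
lattice partition functions, where the number of integration variables is polynomial in `L`) need the
Laplace remainder with constants explicit in the dimension; the tree's limit theorems
(`tendsto_laplaceMethod`, `…_fibred`, `…_orbit`) fix the dimension.  This file is the Euclidean core; the
orbit ∕ chart layers are consumed with it exactly as with the limit form.

HONEST FRAMING: classical real analysis; width 0 by itself toward any lattice statement; ⟨24204⟩, ⟨24319⟩ and
every rung stay OPEN; the Yang–Mills mass gap (Clay) is NOT touched; no summit is proved by a line.

## References
* K. W. Breitung, *Asymptotic Approximations for Probability Integrals*, LNM 1592 (1994), Lemma 26 p. 30,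
  Thm 41 p. 56 (leading order; the proof (5.29)–(5.36) made quantitative here). [Breitung1994]
* R. Wong, *Asymptotic Approximations of Integrals*, SIAM Classics 34 (2001), §IX.5 (expansion in INTEGER
  powers of `1/λ` at an interior non-degenerate critical point: odd terms vanish). [Wong2001AsymptoticApproximationsIntegrals]
-/

noncomputable section

open _root_.MeasureTheory _root_.Filter _root_.Set _root_.Module _root_.Metric
open scoped _root_.Topology _root_.Real _root_.InnerProductSpace

namespace Summit.QuantumFields.YangMills.Theorems.QuantitativeLaplace

open Literature.Analysis.Asymptotics
open Literature.Analysis.UnboundedOperators (abs_exp_sub_one_sub_le_sq_mul_exp_abs)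

/-! ## §3 The quantitative Laplace method -/

section Main

/-- The second-order remainder of `e^{−(b_c + b_r)}(1 + l + e)` after removing `1` and the odd first-order
part `−b_c + l`: with `u = −(b_c + b_r)`,
`e^{u}(1+l+e) − 1 + b_c − l = (e^u − 1 − u)(1+l+e) − b_r + e + u(l+e)`, hence the bound. [folklore] -/
theorem abs_laplace_remainder_le (bc br l e : ℝ) :
    |Real.exp (-(bc + br)) * (1 + l + e) - 1 + bc - l| ≤
      |br| + |e| + |bc + br| * (|l| + |e|) + (bc + br) ^ 2 * Real.exp |bc + br| * (1 + |l| + |e|) := by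
  set u : ℝ := -(bc + br) with hu
  have hid : Real.exp u * (1 + l + e) - 1 + bc - l =
      (Real.exp u - 1 - u) * (1 + l + e) + (-br + e + u * (l + e)) := by rw [hu]; ring
  rw [hid]
  have h1 : |Real.exp u - 1 - u| ≤ u ^ 2 * Real.exp |u| := abs_exp_sub_one_sub_le_sq_mul_exp_abs u
  have hu2 : u ^ 2 = (bc + br) ^ 2 := by rw [hu]; ring
  have hua : |u| = |bc + br| := by rw [hu, abs_neg]
  calc |(Real.exp u - 1 - u) * (1 + l + e) + (-br + e + u * (l + e))|
      ≤ |(Real.exp u - 1 - u) * (1 + l + e)| + |-br + e + u * (l + e)| := abs_add_le _ _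
    _ ≤ u ^ 2 * Real.exp |u| * (1 + |l| + |e|) + (|br| + |e| + |u| * (|l| + |e|)) := by
        apply add_le_add
        · rw [abs_mul]
          apply mul_le_mul h1 _ (abs_nonneg _) (by positivity)
          calc |1 + l + e| ≤ |1 + l| + |e| := abs_add_le _ _
            _ ≤ |1| + |l| + |e| := by gcongr; exact abs_add_le _ _
            _ = 1 + |l| + |e| := by rw [abs_one]
        · calc |-br + e + u * (l + e)| ≤ |-br + e| + |u * (l + e)| := abs_add_le _ _
            _ ≤ |-br| + |e| + |u| * |l + e| := by rw [abs_mul]; gcongr; exact abs_add_le _ _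
            _ ≤ |br| + |e| + |u| * (|l| + |e|) := by
                rw [abs_neg]; gcongr; exact abs_add_le _ _
    _ = |br| + |e| + |bc + br| * (|l| + |e|) + (bc + br) ^ 2 * Real.exp |bc + br| * (1 + |l| + |e|) := by
        rw [hu2, hua]; ring

variable {V : Type*} [NormedAddCommGroup V] [InnerProductSpace ℝ V] [FiniteDimensional ℝ V]
  [MeasurableSpace V] [BorelSpace V]
variable {A : V →ₗ[ℝ] V} {lam : ℝ}

omit [FiniteDimensional ℝ V] [MeasurableSpace V] [BorelSpace V] in
/-- **Pointwise second-order bound on the ball.**  With `q = ½⟪Ay,y⟫`, `a = A₃ + A₄R`, `d = D + GR`,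
`τ = 2(A₃R + A₄R²)/λ`: for `‖y‖ ≤ R`,
`|e^{−β(q+c+r)}(1+ℓ+e) − e^{−βq} − e^{−βq}(−βc + ℓ)| ≤ e^{−βq}(G(2/λ)q + β(A₄ + ad)(2/λ)²q²) + 3β²a²(2/λ)³q³e^{−(1−τ)βq}`.
[cite: Breitung1994, Thm 41 proof (5.33)–(5.35) p. 57] -/
theorem laplace_pointwise_remainder_le (hlam : 0 < lam)
    (hcoer : ∀ y : V, lam * ‖y‖ ^ 2 ≤ ⟪A y, y⟫_ℝ)
    {R A₃ A₄ D G β : ℝ} (hA₃ : 0 ≤ A₃) (hA₄ : 0 ≤ A₄) (hD : 0 ≤ D) (hG : 0 ≤ G) (hβ : 0 < β)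
    (hDR : D * R ≤ 1) (hGR : G * R ^ 2 ≤ 1)
    {c r ℓ e : V → ℝ}
    (hc : ∀ y : V, ‖y‖ ≤ R → |c y| ≤ A₃ * ‖y‖ ^ 3) (hr : ∀ y : V, ‖y‖ ≤ R → |r y| ≤ A₄ * ‖y‖ ^ 4)
    (hℓ : ∀ y : V, ‖y‖ ≤ R → |ℓ y| ≤ D * ‖y‖) (he : ∀ y : V, ‖y‖ ≤ R → |e y| ≤ G * ‖y‖ ^ 2)
    (y : V) (hyR : ‖y‖ ≤ R) :
    |(Real.exp (-(β * (((1 / 2) * ⟪A y, y⟫_ℝ) + c y + r y))) * (1 + ℓ y + e y)) - Real.exp (-(β * ((1 / 2) * ⟪A y, y⟫_ℝ))) - (Real.exp (-(β * ((1 / 2) * ⟪A y, y⟫_ℝ))) * (-(β * c y) + ℓ y))| ≤ G * (2 / lam) * (((1 / 2) * ⟪A y, y⟫_ℝ) ^ 1 * Real.exp (-(1 * β * ((1 / 2) * ⟪A y, y⟫_ℝ)))) + β * (A₄ + (A₃ + A₄ * R) * (D + G * R)) * (2 / lam) ^ 2 * (((1 / 2) * ⟪A y, y⟫_ℝ) ^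 2 * Real.exp (-(1 * β * ((1 / 2) * ⟪A y, y⟫_ℝ)))) + 3 * β ^ 2 * (A₃ + A₄ * R) ^ 2 * (2 / lam) ^ 3 * (((1 / 2) * ⟪A y, y⟫_ℝ) ^ 3 * Real.exp (-((1 - 2 * (A₃ * R + A₄ * R ^ 2) / lam) * β * ((1 / 2) * ⟪A y, y⟫_ℝ)))) := by
  set q : ℝ := ((1 / 2) * ⟪A y, y⟫_ℝ) with hq
  set a : ℝ := A₃ + A₄ * R with ha
  set dg : ℝ := D + G * R with hdg
  set τ : ℝ := 2 * (A₃ * R + A₄ * R ^ 2) / lam with hτ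
  have hy0 : 0 ≤ ‖y‖ := norm_nonneg y
  have ha0 : 0 ≤ a := by rw [ha]; have : 0 ≤ R := hy0.trans hyR; positivity
  have hR0 : 0 ≤ R := hy0.trans hyR
  have hdg0 : 0 ≤ dg := by rw [hdg]; positivity
  have hcy := hc y hyR
  have hry := hr y hyR
  have hℓy := hℓ y hyR
  have hey := he y hyR
  have hqy : 0 ≤ q := half_inner_nonneg_of_coercive hlam hcoer y
  have hqny : ‖y‖ ^ 2 ≤ (2 / lam) * q := norm_sq_le_of_coercive hlam hcoer y
  -- `|βc + βr| ≤ β a ‖y‖³` and `≤ τ β q`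
  have hcr0 : |β * c y + β * r y| ≤ β * (A₃ * ‖y‖ ^ 3) + β * (A₄ * ‖y‖ ^ 4) := by
    calc |β * c y + β * r y| ≤ |β * c y| + |β * r y| := abs_add_le _ _
      _ = β * |c y| + β * |r y| := by rw [abs_mul, abs_mul, abs_of_pos hβ]
      _ ≤ β * (A₃ * ‖y‖ ^ 3) + β * (A₄ * ‖y‖ ^ 4) := by gcongr
  have hcr3 : |β * c y + β * r y| ≤ β * a * ‖y‖ ^ 3 := by
    calc |β * c y + β * r y| ≤ β * (A₃ * ‖y‖ ^ 3) + β * (A₄ * ‖y‖ ^ 4) := hcr0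
      _ = β * ‖y‖ ^ 3 * (A₃ + A₄ * ‖y‖) := by ring
      _ ≤ β * ‖y‖ ^ 3 * (A₃ + A₄ * R) := by gcongr
      _ = β * a * ‖y‖ ^ 3 := by rw [ha]; ring
  have hcr2 : |β * c y + β * r y| ≤ τ * β * q := by
    calc |β * c y + β * r y| ≤ β * (A₃ * ‖y‖ ^ 3) + β * (A₄ * ‖y‖ ^ 4) := hcr0
      _ = β * (A₃ * ‖y‖ + A₄ * ‖y‖ ^ 2) * ‖y‖ ^ 2 := by ring
      _ ≤ β * (A₃ * R + A₄ * R ^ 2) * ((2 / lam) * q) := by gcongr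
      _ = τ * β * q := by rw [hτ]; ring
  have hle2 : |ℓ y| + |e y| ≤ dg * ‖y‖ := by
    calc |ℓ y| + |e y| ≤ D * ‖y‖ + G * ‖y‖ ^ 2 := add_le_add hℓy hey
      _ = (D + G * ‖y‖) * ‖y‖ := by ring
      _ ≤ (D + G * R) * ‖y‖ := by gcongr
      _ = dg * ‖y‖ := by rw [hdg]
  have hle3 : 1 + |ℓ y| + |e y| ≤ 3 := by
    have h1 : |ℓ y| ≤ 1 := hℓy.trans ((mul_le_mul_of_nonneg_left hyR hD).trans hDR)
    have h2 : |e y| ≤ 1 := hey.trans ((mul_le_mul_of_nonneg_left (pow_le_pow_left₀ hy0 hyR 2) hG).trans hGR)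
    linarith
  -- factor out the Gaussian
  have hfac : (Real.exp (-(β * (((1 / 2) * ⟪A y, y⟫_ℝ) + c y + r y))) * (1 + ℓ y + e y)) - Real.exp (-(β * ((1 / 2) * ⟪A y, y⟫_ℝ))) - (Real.exp (-(β * ((1 / 2) * ⟪A y, y⟫_ℝ))) * (-(β * c y) + ℓ y)) = Real.exp (-(β * q)) *
      (Real.exp (-(β * c y + β * r y)) * (1 + ℓ y + e y) - 1 + β * c y - ℓ y) := by
    rw [← hq]
    have : Real.exp (-(β * (q + c y + r y))) = Real.exp (-(β * q)) * Real.exp (-(β * c y + β * r y)) := by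
      rw [← Real.exp_add]; congr 1; ring
    rw [this]; ring
  have hrem := abs_laplace_remainder_le (β * c y) (β * r y) (ℓ y) (e y)
  rw [hfac, abs_mul, abs_of_pos (Real.exp_pos _)]
  -- bound the four remainder terms
  have hT1 : |β * r y| ≤ β * A₄ * ‖y‖ ^ 4 := by
    rw [abs_mul, abs_of_pos hβ, mul_assoc]; exact mul_le_mul_of_nonneg_left hry hβ.le
  have hT3 : |β * c y + β * r y| * (|ℓ y| + |e y|) ≤ β * a * dg * ‖y‖ ^ 4 := by
    calc |β * c y + β * r y| * (|ℓ y| + |e y|) ≤ (β * a * ‖y‖ ^ 3) * (dg * ‖y‖) :=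
          mul_le_mul hcr3 hle2 (by positivity) (by positivity)
      _ = β * a * dg * ‖y‖ ^ 4 := by ring
  have hT4 : (β * c y + β * r y) ^ 2 * Real.exp |β * c y + β * r y| * (1 + |ℓ y| + |e y|) ≤
      (β * a * ‖y‖ ^ 3) ^ 2 * Real.exp (τ * β * q) * 3 := by
    apply mul_le_mul _ hle3 (by positivity) (by positivity)
    apply mul_le_mul _ (Real.exp_le_exp.mpr hcr2) (Real.exp_pos _).le (by positivity)
    calc (β * c y + β * r y) ^ 2 = |β * c y + β * r y| ^ 2 := (sq_abs _).symm
      _ ≤ (β * a * ‖y‖ ^ 3) ^ 2 := pow_le_pow_left₀ (abs_nonneg _) hcr3 2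
  have hsum : |Real.exp (-(β * c y + β * r y)) * (1 + ℓ y + e y) - 1 + β * c y - ℓ y| ≤
      G * ‖y‖ ^ 2 + β * (A₄ + a * dg) * ‖y‖ ^ 4 + 3 * β ^ 2 * a ^ 2 * ‖y‖ ^ 6 * Real.exp (τ * β * q) := by
    calc _ ≤ |β * r y| + |e y| + |β * c y + β * r y| * (|ℓ y| + |e y|) +
          (β * c y + β * r y) ^ 2 * Real.exp |β * c y + β * r y| * (1 + |ℓ y| + |e y|) := hrem
      _ ≤ β * A₄ * ‖y‖ ^ 4 + G * ‖y‖ ^ 2 + β * a * dg * ‖y‖ ^ 4 +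
          (β * a * ‖y‖ ^ 3) ^ 2 * Real.exp (τ * β * q) * 3 := by gcongr
      _ = _ := by ring
  -- convert powers of `‖y‖` into powers of `q`
  have hn4 : ‖y‖ ^ 4 ≤ (2 / lam) ^ 2 * q ^ 2 := by
    have := pow_le_pow_left₀ (sq_nonneg ‖y‖) hqny 2
    calc ‖y‖ ^ 4 = (‖y‖ ^ 2) ^ 2 := by ring
      _ ≤ ((2 / lam) * q) ^ 2 := this
      _ = (2 / lam) ^ 2 * q ^ 2 := by ring
  have hn6 : ‖y‖ ^ 6 ≤ (2 / lam) ^ 3 * q ^ 3 := by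
    have := pow_le_pow_left₀ (sq_nonneg ‖y‖) hqny 3
    calc ‖y‖ ^ 6 = (‖y‖ ^ 2) ^ 3 := by ring
      _ ≤ ((2 / lam) * q) ^ 3 := this
      _ = (2 / lam) ^ 3 * q ^ 3 := by ring
  have hexp3 : Real.exp (-(β * q)) * Real.exp (τ * β * q) = Real.exp (-((1 - τ) * β * q)) := by
    rw [← Real.exp_add]; congr 1; ring
  calc Real.exp (-(β * q)) * |Real.exp (-(β * c y + β * r y)) * (1 + ℓ y + e y) - 1 + β * c y - ℓ y|
      ≤ Real.exp (-(β * q)) *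
        (G * ‖y‖ ^ 2 + β * (A₄ + a * dg) * ‖y‖ ^ 4 + 3 * β ^ 2 * a ^ 2 * ‖y‖ ^ 6 * Real.exp (τ * β * q)) :=
        mul_le_mul_of_nonneg_left hsum (Real.exp_pos _).le
    _ ≤ Real.exp (-(β * q)) *
        (G * ((2 / lam) * q) + β * (A₄ + a * dg) * ((2 / lam) ^ 2 * q ^ 2) +
          3 * β ^ 2 * a ^ 2 * ((2 / lam) ^ 3 * q ^ 3) * Real.exp (τ * β * q)) := by
        gcongr
    _ = G * (2 / lam) * (((1 / 2) * ⟪A y, y⟫_ℝ) ^ 1 * Real.exp (-(1 * β * ((1 / 2) * ⟪A y, y⟫_ℝ)))) + β * (A₄ + (A₃ + A₄ * R) * (D + G * R)) * (2 / lam) ^ 2 * (((1 / 2) * ⟪A y, y⟫_ℝ) ^ 2 * Real.exp (-(1 * β * ((1 / 2) * ⟪A y, y⟫_ℝ)))) + 3 * β ^ 2 * (A₃ + A₄ * R) ^ 2 * (2 / lam) ^ 3 * (((1 / 2) * ⟪A y, y⟫_ℝ) ^ 3 * Real.exp (-((1 - 2 * (A₃ * R + A₄ * R ^ 2) / lam)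 * β * ((1 / 2) * ⟪A y, y⟫_ℝ)))) := by
        rw [← hq, ← ha, ← hdg, ← hτ, ← hexp3]
        ring

omit [FiniteDimensional ℝ V] [MeasurableSpace V] [BorelSpace V] in
/-- `τ = 2(A₃R + A₄R²)/λ ≤ 1/(4(m+8))` under the window smallness. [folklore] -/
theorem laplace_tau_le (hlam : 0 < lam) {R A₃ A₄ : ℝ}
    (hsmall : A₃ * R + A₄ * R ^ 2 ≤ lam / (8 * ((finrank ℝ V : ℝ) + 8))) :
    2 * (A₃ * R + A₄ * R ^ 2) / lam ≤ 1 / (4 * ((finrank ℝ V : ℝ) + 8)) := by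
  have hm0 : (0 : ℝ) ≤ (finrank ℝ V : ℝ) := Nat.cast_nonneg _
  rw [div_le_div_iff₀ hlam (by positivity)]
  calc 2 * (A₃ * R + A₄ * R ^ 2) * (4 * ((finrank ℝ V : ℝ) + 8))
      = 4 * ((finrank ℝ V : ℝ) + 8) * (2 * (A₃ * R + A₄ * R ^ 2)) := by ring
    _ ≤ 4 * ((finrank ℝ V : ℝ) + 8) * (2 * (lam / (8 * ((finrank ℝ V : ℝ) + 8)))) := by gcongr
    _ = 1 * lam := by field_simp; ring

omit [FiniteDimensional ℝ V] [MeasurableSpace V] [BorelSpace V] in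
/-- On the ball, `|βc + βr| ≤ τβq` with `τ = 2(A₃R + A₄R²)/λ`. [folklore] -/
theorem laplace_abs_cubic_quartic_le (hlam : 0 < lam)
    (hcoer : ∀ y : V, lam * ‖y‖ ^ 2 ≤ ⟪A y, y⟫_ℝ)
    {R A₃ A₄ β : ℝ} (hA₃ : 0 ≤ A₃) (hA₄ : 0 ≤ A₄) (hβ : 0 < β) {c r : V → ℝ}
    (hc : ∀ y : V, ‖y‖ ≤ R → |c y| ≤ A₃ * ‖y‖ ^ 3) (hr : ∀ y : V, ‖y‖ ≤ R → |r y| ≤ A₄ * ‖y‖ ^ 4)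
    (y : V) (hyR : ‖y‖ ≤ R) :
    |β * c y + β * r y| ≤ 2 * (A₃ * R + A₄ * R ^ 2) / lam * β * ((1 / 2) * ⟪A y, y⟫_ℝ) := by
  have hy0 : 0 ≤ ‖y‖ := norm_nonneg y
  have hqny : ‖y‖ ^ 2 ≤ (2 / lam) * ((1 / 2) * ⟪A y, y⟫_ℝ) := norm_sq_le_of_coercive hlam hcoer y
  have hR0 : 0 ≤ R := hy0.trans hyR
  calc |β * c y + β * r y| ≤ |β * c y| + |β * r y| := abs_add_le _ _
    _ = β * |c y| + β * |r y| := by rw [abs_mul, abs_mul, abs_of_pos hβ]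
    _ ≤ β * (A₃ * ‖y‖ ^ 3) + β * (A₄ * ‖y‖ ^ 4) := by gcongr; exact hc y hyR; exact hr y hyR
    _ = β * ((A₃ * ‖y‖ + A₄ * ‖y‖ ^ 2) * ‖y‖ ^ 2) := by ring
    _ ≤ β * ((A₃ * R + A₄ * R ^ 2) * ((2 / lam) * ((1 / 2) * ⟪A y, y⟫_ℝ))) := by gcongr
    _ = 2 * (A₃ * R + A₄ * R ^ 2) / lam * β * ((1 / 2) * ⟪A y, y⟫_ℝ) := by ring

omit [FiniteDimensional ℝ V] [MeasurableSpace V] [BorelSpace V] in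
/-- On the ball the integrand is bounded by `3` (the phase is `≥ (1 − τ)βq ≥ 0` there). [folklore] -/
theorem laplace_abs_integrand_le_three (hlam : 0 < lam)
    (hcoer : ∀ y : V, lam * ‖y‖ ^ 2 ≤ ⟪A y, y⟫_ℝ)
    {R A₃ A₄ D G β : ℝ} (hA₃ : 0 ≤ A₃) (hA₄ : 0 ≤ A₄) (hD : 0 ≤ D) (hG : 0 ≤ G) (hβ : 0 < β)
    (hsmall : A₃ * R + A₄ * R ^ 2 ≤ lam / (8 * ((finrank ℝ V : ℝ) + 8)))
    (hDR : D * R ≤ 1) (hGR : G * R ^ 2 ≤ 1)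
    {c r ℓ e : V → ℝ}
    (hc : ∀ y : V, ‖y‖ ≤ R → |c y| ≤ A₃ * ‖y‖ ^ 3) (hr : ∀ y : V, ‖y‖ ≤ R → |r y| ≤ A₄ * ‖y‖ ^ 4)
    (hℓ : ∀ y : V, ‖y‖ ≤ R → |ℓ y| ≤ D * ‖y‖) (he : ∀ y : V, ‖y‖ ≤ R → |e y| ≤ G * ‖y‖ ^ 2)
    (y : V) (hyR : ‖y‖ ≤ R) : |(Real.exp (-(β * (((1 / 2) * ⟪A y, y⟫_ℝ) + c y + r y))) * (1 + ℓ y + e y))| ≤ 3 := by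
  set q : ℝ := ((1 / 2) * ⟪A y, y⟫_ℝ) with hq
  have hy0 : 0 ≤ ‖y‖ := norm_nonneg y
  have hm0 : (0 : ℝ) ≤ (finrank ℝ V : ℝ) := Nat.cast_nonneg _
  have hqy : 0 ≤ q := half_inner_nonneg_of_coercive hlam hcoer y
  have hτ := laplace_tau_le (V := V) hlam hsmall
  have hτ1 : 2 * (A₃ * R + A₄ * R ^ 2) / lam ≤ 1 := hτ.trans (by
    rw [div_le_one (by positivity)]; linarith)
  have hcr := laplace_abs_cubic_quartic_le hlam hcoer hA₃ hA₄ hβ hc hr y hyR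
  rw [← hq] at hcr
  have hexp1 : Real.exp (-(β * (q + c y + r y))) ≤ 1 := by
    rw [Real.exp_le_one_iff]
    have h1 := (abs_le.mp hcr).1
    have h2 : 2 * (A₃ * R + A₄ * R ^ 2) / lam * β * q ≤ 1 * β * q :=
      mul_le_mul_of_nonneg_right (mul_le_mul_of_nonneg_right hτ1 hβ.le) hqy
    nlinarith
  have hle3 : |1 + ℓ y + e y| ≤ 3 := by
    have h1 : |ℓ y| ≤ 1 := (hℓ y hyR).trans ((mul_le_mul_of_nonneg_left hyR hD).trans hDR)
    have h2 : |e y| ≤ 1 := (he y hyR).trans ((mul_le_mul_of_nonneg_left (pow_le_pow_left₀ hy0 hyR 2) hG).trans hGR)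
    calc |1 + ℓ y + e y| ≤ |1 + ℓ y| + |e y| := abs_add_le _ _
      _ ≤ |1| + |ℓ y| + |e y| := by gcongr; exact abs_add_le _ _
      _ ≤ 3 := by rw [abs_one]; linarith
  rw [abs_mul, abs_of_pos (Real.exp_pos _)]
  calc Real.exp (-(β * (q + c y + r y))) * |1 + ℓ y + e y| ≤ 1 * 3 :=
        mul_le_mul hexp1 hle3 (abs_nonneg _) zero_le_one
    _ = 3 := by norm_num

omit [FiniteDimensional ℝ V] [MeasurableSpace V] [BorelSpace V] in
/-- On the ball the odd first-order part is bounded. [folklore] -/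
theorem laplace_abs_odd_le (hlam : 0 < lam)
    (hcoer : ∀ y : V, lam * ‖y‖ ^ 2 ≤ ⟪A y, y⟫_ℝ)
    {R A₃ D β : ℝ} (hA₃ : 0 ≤ A₃) (hD : 0 ≤ D) (hβ : 0 < β) {c ℓ : V → ℝ}
    (hc : ∀ y : V, ‖y‖ ≤ R → |c y| ≤ A₃ * ‖y‖ ^ 3) (hℓ : ∀ y : V, ‖y‖ ≤ R → |ℓ y| ≤ D * ‖y‖)
    (y : V) (hyR : ‖y‖ ≤ R) : |(Real.exp (-(β * ((1 / 2) * ⟪A y, y⟫_ℝ))) * (-(β * c y) + ℓ y))| ≤ β * (A₃ * R ^ 3) + D * R := by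
  set q : ℝ := ((1 / 2) * ⟪A y, y⟫_ℝ) with hq
  have hy0 : 0 ≤ ‖y‖ := norm_nonneg y
  have hqy : 0 ≤ q := half_inner_nonneg_of_coercive hlam hcoer y
  have hexp1 : Real.exp (-(β * q)) ≤ 1 := by
    rw [Real.exp_le_one_iff]; nlinarith
  rw [abs_mul, abs_of_pos (Real.exp_pos _)]
  have h2 : |-(β * c y) + ℓ y| ≤ β * (A₃ * R ^ 3) + D * R := by
    calc |-(β * c y) + ℓ y| ≤ |-(β * c y)| + |ℓ y| := abs_add_le _ _
      _ = β * |c y| + |ℓ y| := by rw [abs_neg, abs_mul, abs_of_pos hβ]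
      _ ≤ β * (A₃ * ‖y‖ ^ 3) + D * ‖y‖ := by gcongr; exact hc y hyR; exact hℓ y hyR
      _ ≤ β * (A₃ * R ^ 3) + D * R := by gcongr
  calc Real.exp (-(β * q)) * |-(β * c y) + ℓ y| ≤ 1 * (β * (A₃ * R ^ 3) + D * R) :=
        mul_le_mul hexp1 h2 (abs_nonneg _) zero_le_one
    _ = _ := one_mul _

end Main

end Summit.QuantumFields.YangMills.Theorems.QuantitativeLaplace
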